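/-
Copyright (c) 2026. Released under the Apache 2.0 license.
-/
import Literature.NumberTheory.EllipticCurves.ManinConstantQuadraticTwistAtTwoOrdinaryProofs
import Literature.NumberTheory.EllipticCurves.ManinConstantQuadraticTwistAtTwoCremonaRangeProofs
import HarnessLib

/-!
# `|c₀(𝒜)| = 1` by twist-descent into Cremona's printed range at the prime `2`, in EVERY case
# `η = 1` of Stevens' Lemma (5.2): `𝒜 = 𝒜' ⊗ χ` (`χ = χ₋₄, χ₈, χ₋₈`), `𝒜'` semistable at `2` with
# `d = −1`, or `𝒜'` multiplicative at `2`, or `a₂(𝒜')` odd (good ordinary) — and `N(𝒜') ≤ 130000`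

[Proofs] Theorems only (no definition, no named fact; D-0026). Topic
`Literature/NumberTheory/EllipticCurves`; namespace `Literature.NumberTheory.EllipticCurves.ModularForms`.

`ManinConstantQuadraticTwistAtTwoCremonaRangeProofs.lean` proved the `2`-key of the twist-descent road
(`|c₀| = 1` from Agashe–Ribet–Stein 2006 Thm. 2.6 at the partner, `h26`, + modularity `hnf`) in the
cases `η = 1` decided by the conductor of the partner: `d = −1`, or `𝒜'` multiplicative at `2`
(manin-r1's `neronLattice_quadraticTwist_two`). `ManinConstantQuadraticTwistAtTwoOrdinaryProofs.lean`
(manin-r1) has since proved Stevens' Lemma (5.2) at `2` in EVERY case `η = 1`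
(`neronLattice_quadraticTwist_two_of_etaOne`: also `d = ±2` with `𝒜'` good ORDINARY at `2`, read off
`a₂(𝒜') = (L(𝒜', s))₂` odd). This file widens the `2`-key accordingly — the clause
`d = −1 ∨ 2 ∣ N(W')` becomes `d = −1 ∨ 2 ∣ N(W') ∨ a₂(W')` odd — with the same ending
(`maninConstant_dvd_of_charTwist_gamma0` + `h26`):

* `abs_maninConstant_eq_one_of_isTwistOfSemistableAtTwo_etaOne_conductorNorm_le` — per pair,
  displayed `d`, `W ∼ W' ⊗ χ_d`, `N(W') ∣ N(W)`, `(4|d|)² ∣ N(W)`, `4 ∤ N(W')`,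
  `d = −1 ∨ 2 ∣ N(W') ∨ a₂(W')` odd, `W` additive at `2`, `N(W') ≤ 130000`; binders `h26 hnf`.
* `abs_maninConstant_eq_one_of_exists_twistAtTwo_etaOne_of_conductorNorm_le` — from a displayed
  witness `(d, V)` in the shape of manin-r1's `not_dvd_maninConstant_of_exists_twistAtTwo_etaOne_gamma0`
  plus `N(W') ≤ 8·130000` (then `N(V) ≤ N(W')/8 ≤ 130000`; automatic for `N(W') ≤ 500000`).
* `classAbsManinConstantEqOne_of_forall_exists_twistKey_etaOne_of_level_le` — the class certificate
  with odd keys (`I₀*`/`I_ν*`/`TwistSemistableWitnessAt` with level clauses) OR the widened `2`-key.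
  Binders `h26 hnf` ONLY. The only twist-shaped case at `2` still outside is `η = 2` (`d = ±2`,
  `𝒜'` good supersingular at `2`), where Stevens' lemma gives `c₀ ∣ 2·c(D')` only.

## References
* [AgasheRibetStein2006] A. Agashe, K. Ribet, W. A. Stein, *The Manin constant*, with an
  appendix by J. Cremona, Pure Appl. Math. Q. 2 (2006) 617–636: Thm. 2.6 (p. 619), appendix
  Thm. 5.2 (p. 633), Thm. 5.4 (p. 634).
* [Stevens1989] G. Stevens, Invent. Math. 98 (1989): Lemma (5.2) p. 96 (the definition of `η`),
  Lemma (5.4) p. 97.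
* [SilvermanAEC2009] J. H. Silverman, *AEC*, V.4 and Exercise 5.10(a) (ordinary at `2`).
* [Pal2012] V. Pal, J. Number Theory 132 (2012), Prop. 2.4–2.5, Lemma 3.1.
-/

noncomputable section

open scoped MatrixGroups ModularForm Classical

open CongruenceSubgroup WeierstrassCurve IsDedekindDomain IsDedekindDomain.HeightOneSpectrum
  NumberField Rat.HeightOneSpectrum Literature.NumberTheory.Automorphic

namespace Literature.NumberTheory.EllipticCurves.ModularForms

/-! ### Elementary bookkeeping -/

section Elementary

/-- A divisor of `±1` is `±1`. [folklore] -/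
private theorem abs_eq_one_of_dvd_of_abs_eq_one₂ {a b : ℤ} (h : a ∣ b) (hb : |b| = 1) : |a| = 1 :=
  Int.isUnit_iff_abs_eq.mp (isUnit_of_dvd_unit h (Int.isUnit_iff_abs_eq.mpr hb))

/-- If `a ∣ n`, the `q`-adic valuation of `n` exceeds that of `a` by at least `k`, and
`n ≤ B·qᵏ`, then `a ≤ B`. [folklore] -/
private theorem le_of_dvd_of_factorization_le₂ {a n q k B : ℕ} (hq : q.Prime) (ha : a ≠ 0)
    (hn : n ≠ 0) (hdvd : a ∣ n) (hfac : a.factorization q + k ≤ n.factorization q)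
    (hlev : n ≤ B * q ^ k) : a ≤ B := by
  obtain ⟨t, rfl⟩ := hdvd
  have ht : t ≠ 0 := fun h ↦ hn (by rw [h, mul_zero])
  have hk : k ≤ t.factorization q := by
    have h := hfac
    rw [Nat.factorization_mul ha ht, Finsupp.add_apply] at h
    omega
  have hqt : q ^ k ∣ t := (hq.pow_dvd_iff_le_factorization ht).mpr hk
  have hqt' : q ^ k ≤ t := Nat.le_of_dvd (Nat.pos_of_ne_zero ht) hqt
  have h1 : a * q ^ k ≤ B * q ^ k := (Nat.mul_le_mul_left a hqt').trans hlev
  exact le_of_mul_le_mul_right h1 (pow_pos hq.pos k)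

end Elementary

/-! ### `|c₀(𝒜)| = 1` when `𝒜 = 𝒜' ⊗ χ` (`χ = χ₋₄, χ₈, χ₋₈`), `𝒜'` semistable at `2` of conductor `≤ 130000` -/

section Manin

variable {W : WeierstrassCurve ℚ} [W.IsElliptic]
  {W' : WeierstrassCurve ℚ} [W'.IsElliptic] [W'.IsGloballyMinimal]

/-- The core of the per-pair theorem at `2`, for a given primitive quadratic character `χ` mod `m`
with `g(χ)² = 4d`, `m² ∣ N(W)`, carrying the odd-`n` twisting identity `aₙ(W' ⊗ d) = χ(n) aₙ(W')`
and vanishing at even `n`, in every case `η = 1` (`d = −1 ∨ 2 ∣ N(W') ∨ a₂(W')` odd; shape of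
manin-r1's `not_dvd_maninConstant_of_isTwistOfSemistableAtTwo_etaOne_gamma0_of_char`), with the
partner level bound `N(W') ≤ 130000` and the conclusion `|c| = 1` from Agashe–Ribet–Stein 2006
Thm. 2.6 (`h26`).
[cite: AgasheRibetStein2006, Thm. 2.6 (p. 619)] [cite: Stevens1989, Lemmas (5.2), (5.4)] -/
theorem abs_maninConstant_eq_one_of_isTwistOfSemistableAtTwo_etaOne_conductorNorm_le_of_char
    (h26 : AgasheRibetStein2006.cremona_abs_maninConstant_eq_one_of_level_le)
    (hnf : exists_isNewformOf)
    {d : ℤ} (hd : d = -1 ∨ d = 2 ∨ d = -2)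
    {m : ℕ} [NeZero m] {χ : DirichletCharacter ℂ m} (hχq : χ.IsQuadratic) (hχp : χ.IsPrimitive)
    (hG : gaussSum χ (ZMod.stdAddChar (N := m)) ^ 2 = ((4 * d : ℤ) : ℂ))
    (hχodd : ∀ n : ℕ, ¬ 2 ∣ n →
      (((W'.quadraticTwist (d : ℚ)).LFunction n : ℤ) : ℂ) = χ n * ((W'.LFunction n : ℤ) : ℂ))
    (hχeven : ∀ n : ℕ, 2 ∣ n → χ n = 0)
    (htw : IsIsogenous W (W'.quadraticTwist (d : ℚ)))
    (hN'N : W'.conductorNorm ℤ ∣ W.conductorNorm ℤ) (hmN : m ^ 2 ∣ W.conductorNorm ℤ)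
    (h4N' : ¬ 2 ^ 2 ∣ W'.conductorNorm ℤ)
    (hη : d = -1 ∨ 2 ∣ W'.conductorNorm ℤ ∨ Odd (W'.LFunction 2))
    (hadd : ¬ W.HasGoodReductionAtPrime 2 ∧ ¬ W.HasMultiplicativeReductionAtPrime 2)
    (hlev : W'.conductorNorm ℤ ≤ 130000)
    (W₀ : WeierstrassCurve ℚ) [W₀.IsElliptic] [W₀.IsGloballyMinimal] {N₀ : ℕ} [NeZero N₀]
    (D₀ : ModularParametrizationData W₀ N₀) (hiso : IsIsogenous W W₀)
    (h₀ : ∀ z ∈ D₀.L.lattice, ∃ w ∈ periodLattice D₀.f, z = D₀.c * w) :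
    |D₀.maninConstant| = 1 := by
  haveI : Fact (Nat.Prime 2) := ⟨Nat.prime_two⟩
  have hdZ : d ≠ 0 := by rcases hd with rfl | rfl | rfl <;> norm_num
  have hd0 : (d : ℚ) ≠ 0 := by exact_mod_cast hdZ
  -- the levels are the conductors
  have hLW₀ : W.LFunction = W₀.LFunction := LFunction_eq_of_isIsogenous_holds W W₀ hiso
  have hnfW : IsNewformOf W D₀.f :=
    ⟨D₀.isNewformOf.1, fun n ↦ by rw [D₀.isNewformOf.2 n, hLW₀]⟩
  have hN₀ : N₀ = W.conductorNorm ℤ :=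
    IsNewformOf.level_eq_conductorNorm_of_exists_isNewformOf hnf hnfW
  haveI : NeZero (W'.conductorNorm ℤ) := ⟨(conductorNorm_pos_holds W').ne'⟩
  -- the optimal `X₀`-datum `D'` of `𝒜'`, on a globally minimal `W₁' ∼ W'`
  obtain ⟨f', hf'⟩ := hnf W'
  obtain ⟨W₁', hE₁', hM₁', D', hD'f, hiso₁, hmin⟩ :=
    exists_optimal_modularParametrizationData_of_isNewformOf' (W'.conductorNorm ℤ) W' rfl hf'
  haveI := hE₁'
  haveI := hM₁'
  have hopt' : ∀ z ∈ D'.L.lattice, ∃ w ∈ periodLattice D'.f, z = D'.c * w :=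
    D'.latticeEq_of_forall_modularDegree_le fun W₂ _ D₂ h2 ↦ hmin W₂ D₂ (h2.trans hD'f)
  -- `W₁'` is semistable at `2` (its conductor is the level `N(W')`, `4 ∤ N(W')`),
  -- multiplicative there when `2 ∣ N(W')`, and `a₂(W₁') = a₂(W')`
  have hN'₁ : W'.conductorNorm ℤ = W₁'.conductorNorm ℤ :=
    IsNewformOf.level_eq_conductorNorm_of_exists_isNewformOf hnf D'.isNewformOf
  have hsemi : W₁'.HasGoodReductionAtPrime 2 ∨ W₁'.HasMultiplicativeReductionAtPrime 2 :=
    hasGoodReductionAtPrime_or_hasMultiplicativeReductionAtPrime_of_not_sq_dvd_conductorNorm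
      (by rw [← hN'₁]; exact h4N')
  have hη₁ : d = -1 ∨ W₁'.HasMultiplicativeReductionAtPrime 2 ∨ Odd (W₁'.LFunction 2) := by
    rcases hη with h | h2N | hodd
    · exact Or.inl h
    · right
      rcases hsemi with hg | hm'
      · -- good at `2` would give `f₂ = 0`, contradicting `2 ∣ N(W₁')`
        exfalso
        set v2 : HeightOneSpectrum ℤ := (primesEquiv (R := ℤ)).symm ⟨2, Nat.prime_two⟩ with hv2
        have hg' : W₁'.HasGoodReductionAt v2 :=
          (W₁'.hasGoodReductionAtPrime_iff_hasGoodReductionAt_holds ⟨2, Nat.prime_two⟩).mp hg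
        have hf0 : W₁'.conductorExponent v2 = 0 := (conductorExponent_eq_zero_iff_holds v2 W₁').mpr hg'
        have hfac : (W₁'.conductorNorm ℤ).factorization 2 = 0 := by
          rw [show (2 : ℕ) = ((⟨2, Nat.prime_two⟩ : Nat.Primes) : ℕ) from rfl,
            factorization_conductorNorm_primesEquiv_symm W₁' ⟨2, Nat.prime_two⟩, ← hv2, hf0]
        rw [hN'₁] at h2N
        have := (Nat.prime_two.dvd_iff_one_le_factorization (conductorNorm_pos_holds W₁').ne').mp h2N
        omega
      · exact Or.inl hm'
    · right; right
      rwa [LFunction_eq_of_isIsogenous_holds W' W₁' hiso₁] at hodd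
  -- the minimal model `C` of `W₁' ⊗ χ` and a Néron pair of it
  haveI : (W₁'.quadraticTwist (d : ℚ)).IsElliptic := W₁'.isElliptic_quadraticTwist hd0
  obtain ⟨vC, hvC⟩ := hasGlobalMinimalModel_rat_holds (W₁'.quadraticTwist (d : ℚ))
  haveI := hvC
  haveI : ((vC • W₁'.quadraticTwist (d : ℚ)).baseChange ℂ).IsElliptic := by
    rw [WeierstrassCurve.baseChange]; infer_instance
  obtain ⟨LC, hC⟩ := exists_isNeronLatticeOf_holds ((vC • W₁'.quadraticTwist (d : ℚ)).baseChange ℂ)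
  -- Stevens (5.2) at `2`, every case `η = 1`: `Λ_C = g(χ)⁻¹ Λ_{W₁'}`
  have hLC : ∀ z : ℂ, z ∈ LC.lattice ↔ gaussSum χ (ZMod.stdAddChar (N := m)) * z ∈ D'.L.lattice :=
    fun z ↦ neronLattice_quadraticTwist_two_of_etaOne D'.isNeronLattice hd hsemi hη₁
      (vC • W₁'.quadraticTwist (d : ℚ)) ⟨vC, rfl⟩ hC hG z
  -- the newform of `𝒜` is the `χ`-twist of that of `𝒜'`
  have hLtw : W.LFunction = (W'.quadraticTwist (d : ℚ)).LFunction := by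
    haveI : (W'.quadraticTwist (d : ℚ)).IsElliptic := W'.isElliptic_quadraticTwist hd0
    exact LFunction_eq_of_isIsogenous_holds _ _ htw
  have hf : ∀ n : ℕ, cuspCoeff D₀.f n = χ n * cuspCoeff D'.f n := by
    intro n
    have hLn : W₀.LFunction n = W.LFunction n := by rw [hLW₀]
    rw [D₀.isNewformOf.2 n, hD'f, hf'.2 n, hLn]
    by_cases h2n : 2 ∣ n
    · have h0 : W.LFunction n = 0 :=
        W.LFunction_apply_eq_zero_of_not_good_of_not_mult 2 hadd.1 hadd.2 h2n
      rw [h0, hχeven n h2n]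
      simp
    · have hLn' : W.LFunction n = (W'.quadraticTwist (d : ℚ)).LFunction n := by rw [hLtw]
      rw [hLn', hχodd n h2n]
  -- conductor bookkeeping at level `N₀ = N(W)`
  have hN : W'.conductorNorm ℤ ∣ N₀ := by rw [hN₀]; exact hN'N
  have hm : m ^ 2 ∣ N₀ := by rw [hN₀]; exact hmN
  -- the twist step on `Γ₀`: `c(D₀) ∣ c(D')`
  have hdvd : D₀.c ∣ D'.c :=
    maninConstant_dvd_of_charTwist_gamma0 D' D₀ h₀ hχq hχp hN hm hf hC hLC
  -- Cremona's theorem (Agashe–Ribet–Stein 2006, Thm. 2.6) at level `N(W') ≤ 130000`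
  have h1 : |D'.maninConstant| = 1 := h26 W₁' D' hopt' hlev
  exact abs_eq_one_of_dvd_of_abs_eq_one₂ hdvd h1

/-- **`|c₀(𝒜)| = 1` for a class `𝒜` that is the twist of a class `𝒜'` SEMISTABLE AT `2` AND OF
CONDUCTOR `≤ 130000` by `χ₋₄`, `χ₈` or `χ₋₈` (`𝒜 = 𝒜' ⊗ ℚ(√d)`, `d ∈ {−1, 2, −2}`), in EVERY case
`η = 1` of Stevens' Lemma (5.2): `d = −1`, or `𝒜'` multiplicative at `2`, or `a₂(𝒜')` odd (good
ordinary at `2`)** — binders `h26 hnf` ONLY. Displayed hypotheses (as in manin-r1's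
`not_dvd_maninConstant_of_isTwistOfSemistableAtTwo_etaOne_gamma0`): `W ∈ 𝒜` (any model), `W' ∈ 𝒜'`
globally minimal, `W ∼ W'.quadraticTwist d`; `N(W') ∣ N(W)`; `(4|d|)² ∣ N(W)`; `4 ∤ N(W')`;
`d = −1 ∨ 2 ∣ N(W') ∨ a₂(W')` odd (`a₂ = W'.LFunction 2`); `W` additive at `2`; `N(W') ≤ 130000`.
Conclusion: every lattice-optimal `X₀`-datum `D₀` of every globally minimal `W₀ ∼ W` has
`|D₀.maninConstant| = 1`. [cite: AgasheRibetStein2006, Thm. 2.6 (p. 619)]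
[cite: Stevens1989, Lemmas (5.2), (5.4) pp. 96–97] [cite: SilvermanAEC2009, V.4 and Exercise 5.10(a)] -/
theorem abs_maninConstant_eq_one_of_isTwistOfSemistableAtTwo_etaOne_conductorNorm_le
    (h26 : AgasheRibetStein2006.cremona_abs_maninConstant_eq_one_of_level_le)
    (hnf : exists_isNewformOf)
    {d : ℤ} (hd : d = -1 ∨ d = 2 ∨ d = -2)
    (htw : IsIsogenous W (W'.quadraticTwist (d : ℚ)))
    (hN'N : W'.conductorNorm ℤ ∣ W.conductorNorm ℤ)
    (hmN : (4 * d.natAbs) ^ 2 ∣ W.conductorNorm ℤ)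
    (h4N' : ¬ 2 ^ 2 ∣ W'.conductorNorm ℤ)
    (hη : d = -1 ∨ 2 ∣ W'.conductorNorm ℤ ∨ Odd (W'.LFunction 2))
    (hadd : ¬ W.HasGoodReductionAtPrime 2 ∧ ¬ W.HasMultiplicativeReductionAtPrime 2)
    (hlev : W'.conductorNorm ℤ ≤ 130000)
    (W₀ : WeierstrassCurve ℚ) [W₀.IsElliptic] [W₀.IsGloballyMinimal] {N₀ : ℕ} [NeZero N₀]
    (D₀ : ModularParametrizationData W₀ N₀) (hiso : IsIsogenous W W₀)
    (h₀ : ∀ z ∈ D₀.L.lattice, ∃ w ∈ periodLattice D₀.f, z = D₀.c * w) :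
    |D₀.maninConstant| = 1 := by
  rcases hd with rfl | rfl | rfl
  · -- `χ₋₄`
    refine abs_maninConstant_eq_one_of_isTwistOfSemistableAtTwo_etaOne_conductorNorm_le_of_char h26 hnf
      (Or.inl rfl) isQuadratic_χ₄_ringHomComp isPrimitive_χ₄_ringHomComp
      (by rw [gaussSum_χ₄_ringHomComp_sq]; norm_num) (fun n hn ↦ ?_) (fun n hn ↦ ?_) htw hN'N
      (by simpa using hmN) h4N' hη hadd hlev W₀ D₀ hiso h₀
    · rw [show ((-1 : ℤ) : ℚ) = -1 by norm_num, W'.LFunction_quadraticTwist_neg_one_apply_of_odd hn,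
        Int.cast_mul, χ₄_ringHomComp_apply_natCast]
    · rw [χ₄_ringHomComp_apply_natCast, ZMod.χ₄_nat_eq_if_mod_four, if_pos (Nat.mod_eq_zero_of_dvd hn)]
      simp
  · -- `χ₈`
    refine abs_maninConstant_eq_one_of_isTwistOfSemistableAtTwo_etaOne_conductorNorm_le_of_char h26 hnf
      (Or.inr (Or.inl rfl)) isQuadratic_χ₈_ringHomComp isPrimitive_χ₈_ringHomComp
      (by rw [gaussSum_χ₈_ringHomComp_sq]; norm_num) (fun n hn ↦ ?_) (fun n hn ↦ ?_) htw hN'N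
      (by simpa using hmN) h4N' hη hadd hlev W₀ D₀ hiso h₀
    · rw [show ((2 : ℤ) : ℚ) = 2 by norm_num, W'.LFunction_quadraticTwist_two_apply_of_odd hn,
        Int.cast_mul, χ₈_ringHomComp_apply_natCast]
    · rw [χ₈_ringHomComp_apply_natCast, ZMod.χ₈_nat_eq_if_mod_eight,
        if_pos ((Nat.mod_eq_zero_of_dvd hn))]
      simp
  · -- `χ₋₈`
    refine abs_maninConstant_eq_one_of_isTwistOfSemistableAtTwo_etaOne_conductorNorm_le_of_char h26 hnf
      (Or.inr (Or.inr rfl)) isQuadratic_χ₈'_ringHomComp isPrimitive_χ₈'_ringHomComp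
      (by rw [gaussSum_χ₈'_ringHomComp_sq]; norm_num) (fun n hn ↦ ?_) (fun n hn ↦ ?_) htw hN'N
      (by simpa using hmN) h4N' hη hadd hlev W₀ D₀ hiso h₀
    · rw [show ((-2 : ℤ) : ℚ) = -2 by norm_num, W'.LFunction_quadraticTwist_neg_two_apply_of_odd hn,
        Int.cast_mul, χ₈'_ringHomComp_apply_natCast]
    · rw [χ₈'_ringHomComp_apply_natCast, ZMod.χ₈'_nat_eq_if_mod_eight,
        if_pos ((Nat.mod_eq_zero_of_dvd hn))]
      simp

end Manin

/-! ### From a displayed witness at `2` in any case `η = 1` -/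

section DisplayedWitness

/-- **From a displayed witness at `2` (any case `η = 1`)**: a parameter `d ∈ {−1, 2, −2}`, a globally
minimal elliptic `V` with `W' ∼ V.quadraticTwist d`, `N(V) ∣ N(W')`, `(4|d|)² ∣ N(W')`, `4 ∤ N(V)`,
`d = −1 ∨ 2 ∣ N(V) ∨ a₂(V)` odd, `W'` additive at `2` (the hypothesis shape of manin-r1's
`not_dvd_maninConstant_of_exists_twistAtTwo_etaOne_gamma0`), together with `N(W') ≤ 8 · 130000`
(so `N(V) ≤ N(W')/8 ≤ 130000`), give `|c| = 1` for every lattice-optimal `X₀`-datum of the globally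
minimal `W'`. Binders `h26 hnf`. [cite: AgasheRibetStein2006, Thm. 2.6]
[cite: Stevens1989, Lemmas (5.2), (5.4)] -/
theorem abs_maninConstant_eq_one_of_exists_twistAtTwo_etaOne_of_conductorNorm_le
    (h26 : AgasheRibetStein2006.cremona_abs_maninConstant_eq_one_of_level_le)
    (hnf : exists_isNewformOf)
    (W' : WeierstrassCurve ℚ) [W'.IsElliptic] [W'.IsGloballyMinimal] {N' : ℕ} [NeZero N']
    (D' : ModularParametrizationData W' N')
    (hopt : ∀ z ∈ D'.L.lattice, ∃ w ∈ periodLattice D'.f, z = D'.c * w)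
    (htw : ∃ (d : ℤ) (V : WeierstrassCurve ℚ) (_ : V.IsElliptic) (_ : V.IsGloballyMinimal),
      (d = -1 ∨ d = 2 ∨ d = -2) ∧ IsIsogenous W' (V.quadraticTwist (d : ℚ)) ∧
      V.conductorNorm ℤ ∣ W'.conductorNorm ℤ ∧ (4 * d.natAbs) ^ 2 ∣ W'.conductorNorm ℤ ∧
      ¬ 2 ^ 2 ∣ V.conductorNorm ℤ ∧ (d = -1 ∨ 2 ∣ V.conductorNorm ℤ ∨ Odd (V.LFunction 2)) ∧
      (¬ W'.HasGoodReductionAtPrime 2 ∧ ¬ W'.HasMultiplicativeReductionAtPrime 2))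
    (hlev : W'.conductorNorm ℤ ≤ 130000 * 2 ^ 3) : |D'.maninConstant| = 1 := by
  obtain ⟨d, V, hVE, hVM, hd, hiso, hdvd, hm, h4, hη, hadd⟩ := htw
  haveI := hVE
  haveI := hVM
  have hW'0 : W'.conductorNorm ℤ ≠ 0 := (conductorNorm_pos_holds W').ne'
  have hV0 : V.conductorNorm ℤ ≠ 0 := (conductorNorm_pos_holds V).ne'
  -- `16 ∣ N(W')`: `(4|d|)² = 16 d²`
  have h16 : 2 ^ 4 ∣ W'.conductorNorm ℤ := by
    refine dvd_trans ?_ hm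
    have : (4 * d.natAbs) ^ 2 = 2 ^ 4 * d.natAbs ^ 2 := by ring
    rw [this]
    exact dvd_mul_right _ _
  have hlevV : V.conductorNorm ℤ ≤ 130000 := by
    have hfacV : (V.conductorNorm ℤ).factorization 2 ≤ 1 := by
      refine not_lt.mp fun hcon ↦ h4 ?_
      exact (Nat.prime_two.pow_dvd_iff_le_factorization hV0).mpr hcon
    have hfacW : 4 ≤ (W'.conductorNorm ℤ).factorization 2 :=
      (Nat.prime_two.pow_dvd_iff_le_factorization hW'0).mp h16
    refine le_of_dvd_of_factorization_le₂ (k := 3) Nat.prime_two hV0 hW'0 hdvd ?_ hlev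
    omega
  exact abs_maninConstant_eq_one_of_isTwistOfSemistableAtTwo_etaOne_conductorNorm_le h26 hnf hd hiso
    hdvd hm h4 hη hadd hlevV W' D' (IsIsogenous.refl_holds W') hopt

end DisplayedWitness

/-! ### The class certificate with keys at the odd primes OR at `2` (every case `η = 1`) -/

/-- **`ClassAbsManinConstantEqOne W` by twist-descent into Cremona's printed range, keys at odd
primes or at `2` in every case `η = 1` — binders `h26 hnf` only.** For a class every globally
minimal member `W'` of which has EITHER an odd prime `p` with (Kodaira `I₀*` at `p` and
`N(W') ≤ 130000·p²`) or (`I_ν*`, `ν ≥ 1`, at `p` and `N(W') ≤ 130000·p`) or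
(`TwistSemistableWitnessAt W' p` and `N(W') ≤ 130000·p`), OR a displayed witness at `2` (`d`, `V`
with `N(V) ∣ N(W')`, `(4|d|)² ∣ N(W')`, `4 ∤ N(V)`, `d = −1 ∨ 2 ∣ N(V) ∨ a₂(V)` odd, `W'` additive
at `2`) and `N(W') ≤ 8·130000`, the class has `|c| = 1` for every optimal `X₀`-datum of every
globally minimal member. [cite: AgasheRibetStein2006, Thm. 2.6 (p. 619) and appendix Thms. 5.2, 5.4]
[cite: Stevens1989, Lemmas (5.2), (5.4)] [cite: SilvermanATAEC1994, IV.11.1 table p. 368]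
[cite: SilvermanAEC2009, V.4 and Exercise 5.10(a)] -/
theorem classAbsManinConstantEqOne_of_forall_exists_twistKey_etaOne_of_level_le
    (h26 : AgasheRibetStein2006.cremona_abs_maninConstant_eq_one_of_level_le)
    (hnf : exists_isNewformOf)
    (W : WeierstrassCurve ℚ)
    (hcov : ∀ (W' : WeierstrassCurve ℚ) [W'.IsElliptic] [W'.IsGloballyMinimal], IsIsogenous W W' →
      (∃ (p : ℕ) (hp : p.Prime), p ≠ 2 ∧
        ((W'.kodairaSymbolAt ((primesEquiv (R := ℤ)).symm ⟨p, hp⟩) = .Istar 0 ∧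
            W'.conductorNorm ℤ ≤ 130000 * p ^ 2) ∨
         ((∃ n : ℕ, W'.kodairaSymbolAt ((primesEquiv (R := ℤ)).symm ⟨p, hp⟩) = .Istar (n + 1)) ∧
            W'.conductorNorm ℤ ≤ 130000 * p) ∨
         (@TwistSemistableWitnessAt W' p ⟨hp⟩ ∧ W'.conductorNorm ℤ ≤ 130000 * p))) ∨
      ((∃ (d : ℤ) (V : WeierstrassCurve ℚ) (_ : V.IsElliptic) (_ : V.IsGloballyMinimal),
        (d = -1 ∨ d = 2 ∨ d = -2) ∧ IsIsogenous W' (V.quadraticTwist (d : ℚ)) ∧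
        V.conductorNorm ℤ ∣ W'.conductorNorm ℤ ∧ (4 * d.natAbs) ^ 2 ∣ W'.conductorNorm ℤ ∧
        ¬ 2 ^ 2 ∣ V.conductorNorm ℤ ∧ (d = -1 ∨ 2 ∣ V.conductorNorm ℤ ∨ Odd (V.LFunction 2)) ∧
        (¬ W'.HasGoodReductionAtPrime 2 ∧ ¬ W'.HasMultiplicativeReductionAtPrime 2)) ∧
       W'.conductorNorm ℤ ≤ 130000 * 2 ^ 3)) :
    ClassAbsManinConstantEqOne W := by
  intro W' _ _ N' _ D' hiso hopt
  have hN' : N' = W'.conductorNorm ℤ :=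
    IsNewformOf.level_eq_conductorNorm_of_exists_isNewformOf hnf D'.isNewformOf
  subst hN'
  rcases hcov W' hiso with ⟨p, hp, hp2, h⟩ | ⟨htw, hlev⟩
  · rcases h with ⟨hK, hlev⟩ | ⟨⟨n, hK⟩, hlev⟩ | ⟨htw, hlev⟩
    · exact abs_maninConstant_eq_one_of_kodairaSymbolAt_eq_Istar_zero_of_level_le h26 hnf D' hopt hp
        hp2 hK hlev
    · exact abs_maninConstant_eq_one_of_kodairaSymbolAt_eq_Istar_succ_of_level_le h26 hnf D' hopt hp
        hp2 hK hlev
    · haveI : Fact p.Prime := ⟨hp⟩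
      exact abs_maninConstant_eq_one_of_twistSemistableWitnessAt_of_conductorNorm_le h26 hnf W' D'
        hopt htw hlev
  · exact abs_maninConstant_eq_one_of_exists_twistAtTwo_etaOne_of_conductorNorm_le h26 hnf W' D'
      hopt htw hlev

/-- The binder form carried by consumers (keys at odd primes or at `2`, every case `η = 1`): `p ∤ c`
for EVERY prime `p` and every optimal `X₀`-datum of every globally minimal member, modulo `h26 hnf`.
[cite: AgasheRibetStein2006, Thm. 2.6] [cite: Stevens1989, Lemmas (5.2), (5.4)] -/
theorem not_dvd_maninConstant_of_forall_exists_twistKey_etaOne_of_level_le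
    (h26 : AgasheRibetStein2006.cremona_abs_maninConstant_eq_one_of_level_le)
    (hnf : exists_isNewformOf)
    {W : WeierstrassCurve ℚ}
    (hcov : ∀ (W' : WeierstrassCurve ℚ) [W'.IsElliptic] [W'.IsGloballyMinimal], IsIsogenous W W' →
      (∃ (p : ℕ) (hp : p.Prime), p ≠ 2 ∧
        ((W'.kodairaSymbolAt ((primesEquiv (R := ℤ)).symm ⟨p, hp⟩) = .Istar 0 ∧
            W'.conductorNorm ℤ ≤ 130000 * p ^ 2) ∨
         ((∃ n : ℕ, W'.kodairaSymbolAt ((primesEquiv (R := ℤ)).symm ⟨p, hp⟩) = .Istar (n + 1)) ∧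
            W'.conductorNorm ℤ ≤ 130000 * p) ∨
         (@TwistSemistableWitnessAt W' p ⟨hp⟩ ∧ W'.conductorNorm ℤ ≤ 130000 * p))) ∨
      ((∃ (d : ℤ) (V : WeierstrassCurve ℚ) (_ : V.IsElliptic) (_ : V.IsGloballyMinimal),
        (d = -1 ∨ d = 2 ∨ d = -2) ∧ IsIsogenous W' (V.quadraticTwist (d : ℚ)) ∧
        V.conductorNorm ℤ ∣ W'.conductorNorm ℤ ∧ (4 * d.natAbs) ^ 2 ∣ W'.conductorNorm ℤ ∧
        ¬ 2 ^ 2 ∣ V.conductorNorm ℤ ∧ (d = -1 ∨ 2 ∣ V.conductorNorm ℤ ∨ Odd (V.LFunction 2)) ∧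
        (¬ W'.HasGoodReductionAtPrime 2 ∧ ¬ W'.HasMultiplicativeReductionAtPrime 2)) ∧
       W'.conductorNorm ℤ ≤ 130000 * 2 ^ 3))
    (W' : WeierstrassCurve ℚ) [W'.IsElliptic] [W'.IsGloballyMinimal] {N' : ℕ} [NeZero N']
    (D' : ModularParametrizationData W' N') (hiso : IsIsogenous W W')
    (hopt : ∀ z ∈ D'.L.lattice, ∃ w ∈ periodLattice D'.f, z = D'.c * w)
    (p : ℕ) (hp : p.Prime) : ¬ (p : ℤ) ∣ D'.maninConstant :=
  (classAbsManinConstantEqOne_of_forall_exists_twistKey_etaOne_of_level_le h26 hnf W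
    hcov).not_dvd_maninConstant D' hiso hopt hp

end Literature.NumberTheory.EllipticCurves.ModularForms

end
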